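import Literature.Analysis.Calculus.SphereSpectralShell
import Mathlib.Analysis.SpecialFunctions.Trigonometric.Inverse
import Mathlib.Analysis.SpecialFunctions.Trigonometric.Deriv
import Mathlib.Analysis.Calculus.MeanValue
import Mathlib.Analysis.InnerProductSpace.Projection.FiniteDimensional
import HarnessLib

/-!
# Rigidity on spheres: positivity of sphere integrals and angularly constant functions

Analysis support file (everything proved; no definitions, no named facts) for the
spherical-harmonics route to the sharp Poincaré inequality on spheres
(`SphereSpectralShell`; A. Waldron, Invent. math. 217 (2019), Lemma 3.5): the two qualitative
inputs of the shell estimate's zero-eigenvalue clause.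

* `eq_zero_on_sphere_of_sphereIntegral_sq_eq_zero` — a function continuous off the origin with
  `∮_{S_r} g² = 0` vanishes on `S_r` (the sphere measure charges open sets);
* `sum_sum_inner_mul_inner_smul_angularField` — `∑ᵢ∑ⱼ ⟨z,bᵢ⟩⟨w,bⱼ⟩ L_{ij}(z) = ‖z‖² w − ⟨z,w⟩ z`:
  the angular fields span the tangent space, whence `fderiv_eq_zero_of_angDeriv_eq_zero`;
* `eq_of_angDeriv_eq_zero_on_sphere` — if all `∂_{L_{ij}} e` vanish on `S_r` (`dim E ≥ 2`) then
  `e` is constant on `S_r` (great circles `cos t · x + sin t · r u`);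
* `const_on_sphere_of_sphLaplacian_eq_zero` — if `T e = 0` on `S_r` for `e ∈ C²` then `e` is
  constant on `S_r` (`Q_r(e,e) = −∮ e Te = 0`).

References: (spherical harmonics) [folklore]; A. Waldron, Invent. math. 217 (2019), Lemma 3.5
[Waldron2019].
-/

noncomputable section

open MeasureTheory Set Metric Filter Real
open scoped Topology RealInnerProductSpace
open Literature.Analysis.FluidPDE

namespace Literature.Analysis.Calculus

section Algebra

variable {E : Type*} [NormedAddCommGroup E] [InnerProductSpace ℝ E]
variable {ι : Type*} [Fintype ι]

/-- **The angular fields span the tangent spaces**: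
`∑ᵢ∑ⱼ ⟨z,bᵢ⟩⟨w,bⱼ⟩ L_{ij}(z) = ‖z‖² w − ⟨z,w⟩ z`. [folklore] -/
theorem sum_sum_inner_mul_inner_smul_angularField (b : OrthonormalBasis ι ℝ E) (z w : E) :
    ∑ i, ∑ j, (⟪z, b i⟫ * ⟪w, b j⟫) • angularField b i j z = (‖z‖ ^ 2) • w - ⟪z, w⟫ • z := by
  simp only [angularField, smul_sub, smul_smul]
  rw [Finset.sum_comm]
  simp only [Finset.sum_sub_distrib]
  have h1 : ∑ j, ∑ i, (⟪z, b i⟫ * ⟪w, b j⟫ * ⟪z, b i⟫) • b j = (‖z‖ ^ 2) • w := by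
    have : ∀ j, ∑ i, (⟪z, b i⟫ * ⟪w, b j⟫ * ⟪z, b i⟫) • b j = (‖z‖ ^ 2 * ⟪w, b j⟫) • b j := by
      intro j
      rw [← Finset.sum_smul]
      congr 1
      rw [← real_inner_self_eq_norm_sq, ← b.sum_inner_mul_inner z z, Finset.sum_mul]
      exact Finset.sum_congr rfl fun i _ => by rw [real_inner_comm (b i) z]; ring
    simp_rw [this, ← smul_smul, ← Finset.smul_sum]
    congr 1
    conv_rhs => rw [← b.sum_repr' w]
    exact Finset.sum_congr rfl fun j _ => by rw [real_inner_comm]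
  have h2 : ∑ j, ∑ i, (⟪z, b i⟫ * ⟪w, b j⟫ * ⟪z, b j⟫) • b i = ⟪z, w⟫ • z := by
    rw [Finset.sum_comm]
    have : ∀ i, ∑ j, (⟪z, b i⟫ * ⟪w, b j⟫ * ⟪z, b j⟫) • b i = (⟪z, w⟫ * ⟪z, b i⟫) • b i := by
      intro i
      rw [← Finset.sum_smul]
      congr 1
      rw [← real_inner_comm z w, ← b.sum_inner_mul_inner w z, Finset.sum_mul]
      exact Finset.sum_congr rfl fun j _ => by
        rw [real_inner_comm (b j) z]; ring
    simp_rw [this, ← smul_smul, ← Finset.smul_sum]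
    congr 1
    conv_rhs => rw [← b.sum_repr' z]
    exact Finset.sum_congr rfl fun i _ => by rw [real_inner_comm]
  rw [h1, h2]

/-- If all angular derivatives of `e` vanish at `z ≠ 0`, then so does every tangential derivative.
[folklore] -/
theorem fderiv_eq_zero_of_angDeriv_eq_zero (b : OrthonormalBasis ι ℝ E) {e : E → ℝ} {z : E}
    (hz : z ≠ 0) (h : ∀ i j, angDeriv b i j e z = 0) {w : E} (hw : ⟪z, w⟫ = 0) :
    fderiv ℝ e z w = 0 := by
  have hid := sum_sum_inner_mul_inner_smul_angularField b z w
  rw [hw, zero_smul, sub_zero] at hid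
  have hz2 : ‖z‖ ^ 2 ≠ 0 := pow_ne_zero 2 (norm_ne_zero_iff.2 hz)
  have hw' : w = (‖z‖ ^ 2)⁻¹ • ∑ i, ∑ j, (⟪z, b i⟫ * ⟪w, b j⟫) • angularField b i j z := by
    rw [hid, smul_smul, inv_mul_cancel₀ hz2, one_smul]
  rw [hw', map_smul, map_sum]
  simp only [map_sum, map_smul, smul_eq_mul]
  simp only [angDeriv] at h
  simp [h]

end Algebra

section Sphere

variable {E : Type*} [NormedAddCommGroup E] [InnerProductSpace ℝ E] [FiniteDimensional ℝ E]
  [MeasurableSpace E] [BorelSpace E]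
variable {ι : Type*} [Fintype ι]

/-- **Positivity**: a function continuous off the origin with `∮_{S_r} g² = 0` (`r > 0`) vanishes
on `S_r`. [folklore] -/
theorem eq_zero_on_sphere_of_sphereIntegral_sq_eq_zero {g : E → ℝ} (hg : ContinuousOn g {0}ᶜ)
    {r : ℝ} (hr : 0 < r)
    (h : sphereIntegral (volume : Measure E) (fun x => g x ^ 2) r = 0) :
    ∀ x, ‖x‖ = r → g x = 0 := by
  have hc : Continuous fun θ : sphere (0 : E) 1 => g (r • (θ : E)) :=
    hg.comp_continuous (continuous_const.smul continuous_subtype_val)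
      fun θ => smul_sphere_ne_zero' hr θ
  have hc2 : Continuous fun θ : sphere (0 : E) 1 => g (r • (θ : E)) ^ 2 := hc.pow 2
  rw [sphereIntegral_def] at h
  have hae := (integral_eq_zero_iff_of_nonneg (fun θ => sq_nonneg _)
    (hc2.integrable_of_hasCompactSupport (HasCompactSupport.of_compactSpace _))).1 h
  have hall := (hc2.ae_eq_iff_eq (volume : Measure E).toSphere continuous_const).1 hae
  intro x hx
  have hx0 : x ≠ 0 := by intro h0; rw [h0, norm_zero] at hx; exact hr.ne' hx.symm
  set θ : sphere (0 : E) 1 := ⟨‖x‖⁻¹ • x, by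
    rw [mem_sphere_zero_iff_norm, norm_smul, norm_inv, norm_norm,
      inv_mul_cancel₀ (norm_ne_zero_iff.2 hx0)]⟩ with hθ
  have h1 := congrFun hall θ
  simp only [hθ] at h1
  rw [hx, smul_smul, mul_inv_cancel₀ hr.ne', one_smul] at h1
  exact pow_eq_zero_iff two_ne_zero |>.1 h1
where
  /-- points of the dilated unit sphere are not the origin -/
  smul_sphere_ne_zero' {r : ℝ} (hr : 0 < r) (θ : sphere (0 : E) 1) : r • (θ : E) ∈ ({0}ᶜ : Set E) := by
    simp only [mem_compl_iff, mem_singleton_iff, smul_eq_zero, not_or]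
    exact ⟨hr.ne', ne_zero_of_mem_unit_sphere θ⟩

omit [FiniteDimensional ℝ E] [MeasurableSpace E] [BorelSpace E] in
/-- In dimension `≥ 2` every vector has a unit vector orthogonal to it. [folklore] -/
theorem exists_unit_orthogonal (h2 : 2 ≤ Module.finrank ℝ E) (x : E) :
    ∃ u : E, ‖u‖ = 1 ∧ ⟪x, u⟫ = 0 := by
  by_cases hx : x = 0
  · haveI : Nontrivial E := Module.nontrivial_of_finrank_pos (R := ℝ) (by omega)
    obtain ⟨u, hu⟩ := exists_norm_eq E (show (0 : ℝ) ≤ 1 by norm_num)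
    exact ⟨u, hu, by simp [hx]⟩
  · haveI : Fact (Module.finrank ℝ E = (Module.finrank ℝ E - 1) + 1) := ⟨by omega⟩
    have hK : Module.finrank ℝ (ℝ ∙ x)ᗮ = Module.finrank ℝ E - 1 :=
      Submodule.finrank_orthogonal_span_singleton hx
    have hpos : 0 < Module.finrank ℝ (ℝ ∙ x)ᗮ := by omega
    haveI : Nontrivial (ℝ ∙ x)ᗮ := Module.nontrivial_of_finrank_pos hpos
    obtain ⟨v, hv⟩ := exists_ne (0 : (ℝ ∙ x)ᗮ)
    have hv0 : (v : E) ≠ 0 := fun h => hv (Subtype.ext h)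
    refine ⟨‖(v : E)‖⁻¹ • (v : E), ?_, ?_⟩
    · rw [norm_smul, norm_inv, norm_norm, inv_mul_cancel₀ (norm_ne_zero_iff.2 hv0)]
    · rw [inner_smul_right, Submodule.mem_orthogonal_singleton_iff_inner_right.1 v.2, mul_zero]

omit [FiniteDimensional ℝ E] [MeasurableSpace E] [BorelSpace E] in
/-- Every point of `S_r` lies on a great circle through `x ∈ S_r`: `y = cos t · x + sin t · r u`
with `u` a unit vector orthogonal to `x` (`dim E ≥ 2`). [folklore] -/
theorem exists_greatCircle_param (h2 : 2 ≤ Module.finrank ℝ E) {r : ℝ} (hr : 0 < r) {x y : E}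
    (hx : ‖x‖ = r) (hy : ‖y‖ = r) :
    ∃ u : E, ‖u‖ = 1 ∧ ⟪x, u⟫ = 0 ∧ ∃ t : ℝ, y = Real.cos t • x + Real.sin t • (r • u) := by
  set c : ℝ := ⟪x, y⟫ / r ^ 2 with hc
  set y' : E := y - c • x with hy'
  have hxy' : ⟪x, y'⟫ = 0 := by
    rw [hy', inner_sub_right, inner_smul_right, real_inner_self_eq_norm_sq, hx, hc]
    field_simp; ring
  -- `‖y‖² = c² r² + ‖y'‖²`
  have hnorm : r ^ 2 = c ^ 2 * r ^ 2 + ‖y'‖ ^ 2 := by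
    have h1 : y = c • x + y' := by rw [hy']; abel
    have h2 : ⟪c • x, y'⟫ = 0 := by rw [inner_smul_left, hxy']; simp
    have h3 := norm_add_sq_eq_norm_sq_add_norm_sq_of_inner_eq_zero (c • x) y' h2
    rw [← h1, hy, norm_smul, Real.norm_eq_abs, hx] at h3
    nlinarith [h3, abs_mul_abs_self c]
  have hc1 : c ^ 2 ≤ 1 := by
    have h5 : c ^ 2 * r ^ 2 ≤ 1 * r ^ 2 := by nlinarith [sq_nonneg ‖y'‖]
    exact le_of_mul_le_mul_right h5 (by positivity)
  have hcle : c ≤ 1 := by nlinarith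
  have hcge : -1 ≤ c := by nlinarith
  by_cases hy0 : y' = 0
  · -- `y = c x` with `c = ±1`
    obtain ⟨u, hu, hxu⟩ := exists_unit_orthogonal h2 x
    refine ⟨u, hu, hxu, Real.arccos c, ?_⟩
    have hc2 : c ^ 2 = 1 := by
      rw [hy0, norm_zero] at hnorm
      have h5 : c ^ 2 * r ^ 2 = 1 * r ^ 2 := by nlinarith [hnorm]
      exact mul_right_cancel₀ (pow_ne_zero 2 hr.ne') h5
    have hsin : Real.sin (Real.arccos c) = 0 := by
      rw [Real.sin_arccos, hc2, sub_self, Real.sqrt_zero]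
    rw [Real.cos_arccos hcge hcle, hsin, zero_smul, add_zero]
    have : y = c • x + y' := by rw [hy']; abel
    rw [this, hy0, add_zero]
  · set u : E := ‖y'‖⁻¹ • y' with hu
    have hy'0 : ‖y'‖ ≠ 0 := norm_ne_zero_iff.2 hy0
    refine ⟨u, ?_, ?_, Real.arccos c, ?_⟩
    · rw [hu, norm_smul, norm_inv, norm_norm, inv_mul_cancel₀ hy'0]
    · rw [hu, inner_smul_right, hxy', mul_zero]
    · have hsin : Real.sin (Real.arccos c) = ‖y'‖ / r := by
        rw [Real.sin_arccos]
        have h1 : 1 - c ^ 2 = (‖y'‖ / r) ^ 2 := by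
          field_simp; nlinarith [hnorm]
        rw [h1, Real.sqrt_sq (by positivity)]
      rw [Real.cos_arccos hcge hcle, hsin, hu, smul_smul, smul_smul,
        show ‖y'‖ / r * r * ‖y'‖⁻¹ = 1 by field_simp, one_smul]
      rw [hy']; abel

omit [FiniteDimensional ℝ E] [MeasurableSpace E] [BorelSpace E] in
/-- **Vanishing angular derivatives force constancy on spheres** (`dim E ≥ 2`): if `e` is `C¹`
off the origin and `∂_{L_{ij}} e = 0` on `S_r` for all `i, j`, then `e` is constant on `S_r`.
[folklore] -/
theorem eq_of_angDeriv_eq_zero_on_sphere (h2 : 2 ≤ Module.finrank ℝ E) (b : OrthonormalBasis ι ℝ E)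
    {e : E → ℝ} (he : ContDiffOn ℝ 1 e {0}ᶜ) {r : ℝ} (hr : 0 < r)
    (h : ∀ i j x, ‖x‖ = r → angDeriv b i j e x = 0) {x y : E} (hx : ‖x‖ = r) (hy : ‖y‖ = r) :
    e x = e y := by
  have hO : IsOpen ({0}ᶜ : Set E) := isOpen_compl_singleton
  obtain ⟨u, hu, hxu, t₀, hyt⟩ := exists_greatCircle_param h2 hr hx hy
  -- the great circle
  set γ : ℝ → E := fun t => Real.cos t • x + Real.sin t • (r • u) with hγ
  have hγnorm : ∀ t, ‖γ t‖ = r := by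
    intro t
    have ha : ‖Real.cos t • x‖ = |Real.cos t| * r := by rw [norm_smul, Real.norm_eq_abs, hx]
    have hb : ‖Real.sin t • (r • u)‖ = |Real.sin t| * r := by
      rw [norm_smul, norm_smul, Real.norm_eq_abs, Real.norm_eq_abs, abs_of_pos hr, hu, mul_one]
    have hab : ⟪Real.cos t • x, Real.sin t • (r • u)⟫ = 0 := by
      rw [inner_smul_left, inner_smul_right, inner_smul_right, hxu]; simp
    have h3 := norm_add_sq_eq_norm_sq_add_norm_sq_of_inner_eq_zero _ _ hab
    rw [ha, hb] at h3
    have h4 : ‖γ t‖ * ‖γ t‖ = r * r := by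
      simp only [hγ]
      rw [h3]
      nlinarith [Real.cos_sq_add_sin_sq t, abs_mul_abs_self (Real.cos t),
        abs_mul_abs_self (Real.sin t)]
    have h5 : ‖γ t‖ ^ 2 = r ^ 2 := by rw [sq, sq, h4]
    exact (sq_eq_sq₀ (norm_nonneg _) hr.le).1 h5
  have hperp : ∀ t, ⟪γ t, -(Real.sin t) • x + Real.cos t • (r • u)⟫ = 0 := by
    intro t
    simp only [hγ, inner_add_left, inner_add_right, inner_smul_left, inner_smul_right,
      real_inner_self_eq_norm_sq, hx, hu, hxu, real_inner_comm x u, RCLike.conj_to_real]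
    ring
  have hγd : ∀ t, HasDerivAt γ (-(Real.sin t) • x + Real.cos t • (r • u)) t := by
    intro t
    have h1 := (Real.hasDerivAt_cos t).smul_const x
    have h2 := (Real.hasDerivAt_sin t).smul_const (r • u)
    exact h1.add h2
  -- `e ∘ γ` has zero derivative
  have hf : ∀ t, HasDerivAt (fun s => e (γ s)) 0 t := by
    intro t
    have hγt : γ t ∈ ({0}ᶜ : Set E) := mem_compl_zero_of_norm_eq hr (hγnorm t)
    have hed : DifferentiableAt ℝ e (γ t) :=
      (he.differentiableOn one_ne_zero).differentiableAt (hO.mem_nhds hγt)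
    have hcomp := hed.hasFDerivAt.comp_hasDerivAt t (hγd t)
    have hzero : fderiv ℝ e (γ t) (-(Real.sin t) • x + Real.cos t • (r • u)) = 0 := by
      refine fderiv_eq_zero_of_angDeriv_eq_zero b (fun h0 => ?_) (fun i j => h i j _ (hγnorm t))
        (hperp t)
      have := hγnorm t; rw [h0, norm_zero] at this; exact hr.ne' this.symm
    rwa [hzero] at hcomp
  have hconst := is_const_of_deriv_eq_zero (fun t => (hf t).differentiableAt)
    (fun t => (hf t).deriv) 0 t₀
  have hγ0 : γ 0 = x := by simp [hγ]
  have hγt₀ : γ t₀ = y := by rw [hyt]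
  simpa [hγ0, hγt₀] using hconst

/-- **A `C²` function annihilated by the spherical Laplacian on `S_r` is constant on `S_r`**
(`dim E ≥ 2`, `r > 0`): `Q_r(e,e) = −∮ e · T e = 0` forces all `∂_{L_{ij}} e` to vanish on `S_r`.
[folklore] -/
theorem const_on_sphere_of_sphLaplacian_eq_zero [Nontrivial E] (h2 : 2 ≤ Module.finrank ℝ E)
    (b : OrthonormalBasis ι ℝ E) {e : E → ℝ} (he : ContDiffOn ℝ 2 e {0}ᶜ) {r : ℝ} (hr : 0 < r)
    (hT : ∀ x, ‖x‖ = r → sphLaplacian b e x = 0) {x y : E} (hx : ‖x‖ = r) (hy : ‖y‖ = r) :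
    e x = e y := by
  have he1 : ContDiffOn ℝ 1 e {0}ᶜ := he.of_le (by norm_num)
  -- `Q_r(e,e) = 0`
  have hQ : sphDirichlet b e e r = 0 := by
    rw [sphDirichlet_eq_neg_sphereIntegral b he1 he hr,
      sphereIntegral_congr_norm hr.le (g := fun _ => (0 : ℝ)) (fun z hz => by rw [hT z hz, mul_zero])]
    simp [sphereIntegral_def]
  -- each `∮ (∂_L e)² = 0`
  have hterm : ∀ i j, sphereIntegral (volume : Measure E) (fun z => angDeriv b i j e z ^ 2) r = 0 := by
    have hnn : ∀ i j, 0 ≤ sphereIntegral (volume : Measure E) (fun z => angDeriv b i j e z ^ 2) r :=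
      fun i j => sphereIntegral_nonneg' (fun z => sq_nonneg _) r
    have hsum : ∑ i, ∑ j, sphereIntegral (volume : Measure E) (fun z => angDeriv b i j e z ^ 2) r = 0 := by
      unfold sphDirichlet at hQ
      have : ∑ i, ∑ j, sphereIntegral (volume : Measure E)
          (fun z => angDeriv b i j e z * angDeriv b i j e z) r = 0 := by linarith
      simpa [sq] using this
    intro i j
    have hi := (Finset.sum_eq_zero_iff_of_nonneg fun i _ => Finset.sum_nonneg fun j _ => hnn i j).1
      hsum i (Finset.mem_univ _)
    exact (Finset.sum_eq_zero_iff_of_nonneg fun j _ => hnn i j).1 hi j (Finset.mem_univ _)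
  have hzero : ∀ i j z, ‖z‖ = r → angDeriv b i j e z = 0 := fun i j =>
    eq_zero_on_sphere_of_sphereIntegral_sq_eq_zero (continuousOn_angDeriv b i j he1 le_rfl) hr
      (hterm i j)
  exact eq_of_angDeriv_eq_zero_on_sphere h2 b he1 hr hzero hx hy

end Sphere

end Literature.Analysis.Calculus
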